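import Summits.BirchSwinnertonDyer.BirchSwinnertonDyer.Theorems.CyclotomicUntwistCornerX10bCubeClass
import Summits.BirchSwinnertonDyer.BirchSwinnertonDyer.Theorems.CyclotomicUntwistCompanionShapeNumLines
import Summits.BirchSwinnertonDyer.Rank1Residual.Additive.LocRedOfStableLine
import HarnessLib

/-!
# LAW L-irr3 at a GOOD ORDINARY `3`: `E[3]` irreducible and `ρ̄₃` not onto force `E[3]|G_{ℚ₃}` SPLIT —
# the W-ALL corner X10b consists of `3`-split curves

Cell `pub/bsd-wall` (D-0145 line `route-BirchSwinnertonDyer-CyclotomicUntwist`), seat `bsd-line-cycu-p4`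
(width seat 4, gen 6). THEOREMS ONLY (no definition, no named fact, no `sorry`); route-free; BSD is not
proved by this file and the corner is NOT closed by it — it is CONFINED. Helper `--supports` K1
(stmt-BirchSwinnertonDyer-21580; same law as on K1's rows).

At a prime of good ORDINARY reduction the local module `E[3]|G_{ℚ₃}` is reducible (kernel of reduction;
tree `Additive.not_locIrr_of_goodOrd'`, Serre §1.11 Prop. 11), so `numStableLinesAtThree W ∈ {1, 2}`
(`CompanionShape.numStableLinesAtThree_le_two`, `O5.locIrr_three_iff_numStableLinesAtThree_eq_zero`).
LAW L-irr3 excludes `1` when `E[3]` is irreducible and `ρ̄₃` is not onto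
(`numStableLinesAtThree_ne_one_of_irr_of_not_surj`). Hence:

* **`numStableLinesAtThree_eq_two_of_goodOrd_of_irr_of_not_surj`**, **`shapeSplitThree_of_goodOrd_of_irr_of_not_surj`**
  — good ordinary `3`, `Irr W 3`, `¬ Surj W 3` ⟹ `E[3]|G_{ℚ₃}` is SPLIT (`ShapeSplitThree W`: two
  `ℚ₃`-roots of `Ψ₃`, `E[3] ≅ χ ⊕ χ′` over `ℚ₃`) — the companion-form situation at `p = 3`;
* **`surj_three_of_goodOrd_of_irr_of_not_shapeSplit`** — at a good ordinary `3`, `E[3]` irreducible and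
  NOT locally split ⟹ `ρ̄_{E,3}` onto;
* the W-ALL corner X10b (`WAll/Target.lean` row 10: `ClassX10 W p ∧ ¬ Surj W p`, `p = 3` good ordinary,
  `Irr`): `shapeSplitThree_of_classX10_of_not_surj` and **`wAllCornerX10b_iff_shapeSplit`** — the corner is
  equivalent to its restriction to the `3`-SPLIT curves; together with `wAllCornerX10b_iff_emod_nine`
  (`Δ_min ≡ ±1 (mod 9)`) this types WHERE corner X10b lives, by theorem.

References: J.-P. Serre, Invent. Math. 15 (1972) §1.11 Prop. 11, §2.4 Prop. 15 [Serre1972]; B. H. Gross,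
Duke Math. J. 61 (1990) (companion forms; context only).
-/

-- single-conjunct summit: `Summit.BirchSwinnertonDyer.BirchSwinnertonDyer.…` repeats the name by design
set_option linter.dupNamespace false
set_option autoImplicit false

noncomputable section

open scoped Classical

namespace Summit.BirchSwinnertonDyer.BirchSwinnertonDyer.Theorems.PSIrrSurjThree

open WeierstrassCurve Literature.NumberTheory.EllipticCurves Literature.NumberTheory.EllipticCurves.Rank1Residual
  Summit.BirchSwinnertonDyer.Rank1Residual Summit.BirchSwinnertonDyer.Rank1Residual.Additive
  Summit.BirchSwinnertonDyer.Rank1Residual.O5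

variable (W : WeierstrassCurve ℚ) [W.IsElliptic] [W.IsGloballyMinimal]

/-- **Good ordinary `3`, irreducible, not onto ⟹ exactly TWO stable lines at `3`.**
[cite: Serre1972, §1.11 Prop. 11 and §2.4 Prop. 15] -/
theorem numStableLinesAtThree_eq_two_of_goodOrd_of_irr_of_not_surj (hgo : GoodOrd W 3) (hirr : Irr W 3)
    (hns : ¬ Surj W 3) : numStableLinesAtThree W = 2 := by
  haveI : Fact (Nat.Prime 3) := ⟨Nat.prime_three⟩
  have h1 := numStableLinesAtThree_ne_one_of_irr_of_not_surj W hirr hns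
  have h0 : numStableLinesAtThree W ≠ 0 := fun h0 ↦
    Additive.not_locIrr_of_goodOrd' W 3 hgo ((locIrr_three_iff_numStableLinesAtThree_eq_zero W).mpr h0)
  have h2 := CompanionShape.numStableLinesAtThree_le_two W
  omega

/-- **Good ordinary `3`, irreducible, not onto ⟹ `E[3]|G_{ℚ₃}` is SPLIT** (two `ℚ₃`-roots of `Ψ₃`).
[cite: Serre1972, §1.11 Prop. 11 and §2.4 Prop. 15] -/
theorem shapeSplitThree_of_goodOrd_of_irr_of_not_surj (hgo : GoodOrd W 3) (hirr : Irr W 3)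
    (hns : ¬ Surj W 3) : ShapeSplitThree W :=
  (CompanionShape.numStableLinesAtThree_eq_two_iff W).mp
    (numStableLinesAtThree_eq_two_of_goodOrd_of_irr_of_not_surj W hgo hirr hns)

/-- **At a good ordinary `3`: `E[3]` irreducible and not locally split ⟹ `ρ̄_{E,3}` onto.**
[cite: Serre1972, §1.11 Prop. 11 and §2.4 Prop. 15] -/
theorem surj_three_of_goodOrd_of_irr_of_not_shapeSplit (hgo : GoodOrd W 3) (hirr : Irr W 3)
    (hsplit : ¬ ShapeSplitThree W) : Surj W 3 := by
  by_contra hns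
  exact hsplit (shapeSplitThree_of_goodOrd_of_irr_of_not_surj W hgo hirr hns)

/-- **Corner X10b curves are `3`-split**: `ClassX10 W p` and `¬ Surj W p` give `ShapeSplitThree W`.
[cite: Serre1972, §1.11 Prop. 11 and §2.4 Prop. 15] -/
theorem shapeSplitThree_of_classX10_of_not_surj {p : ℕ} [Fact p.Prime] (hX : ClassX10 W p) (hns : ¬ Surj W p) :
    ShapeSplitThree W := by
  obtain ⟨rfl, hgo, hirr, -⟩ := hX
  exact shapeSplitThree_of_goodOrd_of_irr_of_not_surj W hgo hirr hns

omit [W.IsElliptic] [W.IsGloballyMinimal] W in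
/-- **The W-ALL corner X10b is confined to the `3`-SPLIT curves**: `WAllCornerX10b` ⟺ its restriction to
`ShapeSplitThree W` (two `ℚ₃`-roots of `Ψ₃`). [cite: Serre1972, §1.11 Prop. 11 and §2.4 Prop. 15] -/
theorem wAllCornerX10b_iff_shapeSplit :
    WAllCornerX10b ↔
      ∀ (W : WeierstrassCurve ℚ) [W.IsElliptic] [W.IsGloballyMinimal] (p : ℕ) [Fact p.Prime],
        ¬ W.HasCM → ClassX10 W p → ¬ Surj W p → ShapeSplitThree W → W.analyticRank ≤ 1 → BSDp W p :=
  ⟨fun h W _ _ p _ hCM hX hns _ hr ↦ h W p hCM hX hns hr,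
    fun h W _ _ p _ hCM hX hns hr ↦ h W p hCM hX hns (shapeSplitThree_of_classX10_of_not_surj W hX hns) hr⟩

end Summit.BirchSwinnertonDyer.BirchSwinnertonDyer.Theorems.PSIrrSurjThree

end
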